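import Literature.NumberTheory.Automorphic.BCDTTheoremBWildAtThreeNormalised
import Literature.NumberTheory.Automorphic.CDTTheorem712ConductorStepProofs
import Literature.RepresentationTheory.Semisimple.Twist
import HarnessLib

/-!
# BCDT Theorem 2.2.1: the assembly through the normalised wild cases 2–6

Topic `NumberTheory/Automorphic`; a companion of `BCDTTheoremB` and of
`BCDTTheoremBWildAtThree{,Det,Cases,Twist,Normalised}`, landed by the tenured seat of the named fact
`Literature.NumberTheory.Automorphic.BCDT.theoremB` (Breuil–Conrad–Diamond–Taylor 2001, Thm. B =
Thm. 2.2.1: every continuous absolutely irreducible `ρ̄ : G_ℚ → GL₂(𝔽₅)` with cyclotomic determinant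
is modular).  No named fact is introduced; everything below is proved.

C. Breuil, B. Conrad, F. Diamond, R. Taylor, J. Amer. Math. Soc. 14 (2001) [BCDTJAMS2001], proof of
Theorem 2.2.1 (p. 860): *"Then up to equivalence and twisting by a quadratic character, one of the
following possibilities can be attained. 1. `ρ̄` is tamely ramified at `3`. 2.–6. …  In each case,
we may choose an elliptic curve … We deduce that `E` is modular, so `ρ̄ ≅ ρ̄_{E,5}` is modular."*

So far the tree assembles Theorem B (`BCDT.theoremB_of_wild_auxiliaryCurve_CDT721`,
`CDTTheorem712ConductorStepProofs`; originally `BCDTTheoremB`) from three deep inputs: the tame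
case needs the Shepherd-Barron–Taylor auxiliary curve
(`exists_isTorsionGaloisRep_five_and_surjective_three`) and CDT Thm. 7.2.1 (`CDT_theorem_7_2_1`),
and the WHOLE wild case is the named fact
`exists_isTorsionGaloisRep_and_isModular_of_not_isTamelyRamifiedAbove` — "for EVERY wild `ρ̄` there
is a modular `E` with `E[5] ≅ ρ̄`" — in which BCDT's preliminary reduction "up to equivalence and
twisting by a quadratic character" is hidden.  That reduction is now a theorem of the tree
(`BCDT.exists_twist_conj_of_not_isTamelyRamifiedAbove_three_of_det`,
`BCDTTheoremBWildAtThreeNormalised`: a twist of `ρ̄` by one of `1, ε₋₃, ε₋₁, ε₋₃ε₋₁` is, after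
conjugation, in the normal form of cases 2–6 on a decomposition group at `3`).  This file threads it
into the assembly:

* `GaloisRepresentations.FramedRep.baseChangeRepresentation_twist`,
  `GaloisRepresentations.FramedRep.isAbsolutelyIrreducible_twist_iff` — twisting a framed
  representation over a field by a continuous character preserves absolute irreducibility (every
  base change of the twist is the twist of the base change; `Representation.isIrreducible_twist_iff`
  of `Literature.RepresentationTheory.Semisimple.Twist`);
* `BCDT.IsWildNormalisedAtThree ρ̄'` — the predicate "`ρ̄'` has cyclotomic determinant, is not tamely
  ramified above `3`, and is in the normal form of BCDT's cases 2–6 at some prime `𝔓 ∣ 3`"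
  (verbatim the conclusion of `exists_twist_conj_of_not_isTamelyRamifiedAbove_three_of_det`);
* `BCDT.exists_quadratic_twist_isWildNormalisedAtThree` — **"up to equivalence and twisting by a
  quadratic character, one of the possibilities 2–6 can be attained"**: for `ρ̄` wild above `3` with
  `det ρ̄ = χ̄₅` there is a continuous character `χ : Γ_ℚ → 𝔽₅^×` with `χ² = 1` (one of
  `1, ε₋₃, ε₋₁, ε₋₁ε₋₃`) such that `ρ̄ ⊗ χ` is wild-normalised and `ρ̄ = (ρ̄ ⊗ χ) ⊗ χ`;
* `BCDT.theoremB_of_wildNormalised_of_twist_of_auxiliaryCurve_CDT721` — **Theorem B from: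
  (i) the wild cases 2–6 FOR NORMALISED `ρ̄'` ONLY** ("for every absolutely irreducible
  wild-normalised `ρ̄'` there is a modular elliptic curve `E / ℚ` with `E[5] ≅ ρ̄'`": BCDT's choice of
  `E₁ / ℚ₃` [Man], of `E / ℚ` [SBT]+Ekedahl, CDT Prop. B.4.2, Lemmas/Thms. 2.1.1–2.1.6,
  Langlands–Tunnell and Thms. 1.4.1–1.4.2 — the content of §§2.1, 2.3, 3–9), **(ii) invariance of
  modularity of `ρ̄` under quadratic twists** (the step BCDT leave tacit in "up to … twisting by a
  quadratic character": if `ρ̄ ⊗ χ ≅ ρ̄_{g,λ}` then `ρ̄ ≅ ρ̄_{g ⊗ χ,λ}`; for BCDT's "eigenform" wording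
  this is Shimura 1971, Prop. 3.64, and for the tree's newform wording of `ModPGaloisRep.IsModular` it
  is that proposition together with the newform attached to an eigenform, Atkin–Li 1978, Thm. 3.2 /
  Li 1975, Thm. 3), **(iii) the auxiliary curve and (iv) CDT Thm. 7.2.1** (the tame case, proved in
  `CDTTheorem712ConductorStepProofs`).  Proof: tame `ρ̄` — case 1; wild `ρ̄` — normalise a quadratic
  twist `ρ̄' = ρ̄ ⊗ χ` (absolutely irreducible with `det = χ̄₅`), take its modular `E`, so `ρ̄'` is
  modular (`IsModular.isModular_of_isTorsionGaloisRep'`, proved), hence so is `ρ̄ = ρ̄' ⊗ χ`;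
* `BCDT.wildNormalised_of_wild` — hypothesis (i) is implied by the old wild-case fact, so the new
  assembly refines the old one; `BCDT.exists_isNewformOf_of_wildNormalised_of_twist_of_auxiliaryCurve_CDT712_722`
  — the same unfolding for Theorem A.

## References

* C. Breuil, B. Conrad, F. Diamond, R. Taylor, *On the modularity of elliptic curves over `ℚ`: wild
  3-adic exercises*, J. Amer. Math. Soc. 14 (2001), 843–939; Thm. 2.2.1 and its proof, p. 860.
  [BCDTJAMS2001]
* G. Shimura, *Introduction to the arithmetic theory of automorphic functions* (1971), Prop. 3.64
  (twists of eigenforms by Dirichlet characters). [Shimura1971]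
* A. O. L. Atkin, W.-C. W. Li, *Twists of newforms and pseudo-eigenvalues of `W`-operators*, Invent.
  Math. 48 (1978), 221–243, §3.
-/

noncomputable section

open scoped NumberField Pointwise
open IsDedekindDomain Field

universe u v w

/-! ## Twisting preserves absolute irreducibility -/

namespace Literature.NumberTheory.GaloisRepresentations

namespace FramedRep

variable {G : Type u} {A : Type v} [Group G] [TopologicalSpace G] [Field A] [TopologicalSpace A]
  [IsTopologicalRing A] {n : ℕ}

/-- **Base change commutes with twisting**: for `f : A →+* B`, the `B`-representation underlying
`(ρ ⊗ χ) ⊗_{A,f} B` is the twist of the one underlying `ρ ⊗_{A,f} B` by the character `f ∘ χ`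
(as matrices, `((χ g • ρ g)).map f = f (χ g) • (ρ g).map f`). [folklore] -/
theorem baseChangeRepresentation_twist {B : Type w} [Field B] (f : A →+* B) (ρ : FramedRep G A n)
    (χ : G →ₜ* Aˣ) :
    (ρ.twist χ).baseChangeRepresentation f =
      RepresentationTheory.Semisimple.Representation.twist (ρ.baseChangeRepresentation f)
        ((Units.map (f : A →* B)).comp χ.toMonoidHom) := by
  refine MonoidHom.ext fun g ↦ LinearMap.ext fun x ↦ ?_
  rw [baseChangeRepresentation_apply_apply,
    RepresentationTheory.Semisimple.Representation.twist_apply_apply,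
    baseChangeRepresentation_apply_apply]
  have hmap : ((Matrix.GeneralLinearGroup.map f (ρ.twist χ g) : GL (Fin n) B) :
        Matrix (Fin n) (Fin n) B) =
      f (χ g : A) • ((Matrix.GeneralLinearGroup.map f (ρ g) : GL (Fin n) B) :
        Matrix (Fin n) (Fin n) B) := by
    change ((ρ.twist χ g : GL (Fin n) A) : Matrix (Fin n) (Fin n) A).map f =
      f (χ g : A) • ((ρ g : GL (Fin n) A) : Matrix (Fin n) (Fin n) A).map f
    rw [coe_twist_apply, Matrix.map_smul' _ _ _ (map_mul f)]
  rw [hmap, Matrix.smul_mulVec]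
  rfl

/-- **Twisting by a continuous character preserves absolute irreducibility** (and conversely,
untwisting by `χ⁻¹`): every base change of `ρ ⊗ χ` is a twist of the corresponding base change of
`ρ`, and a representation and its twists have the same subrepresentations
(`Representation.isIrreducible_twist_iff`). [folklore] -/
theorem isAbsolutelyIrreducible_twist_iff (ρ : FramedRep G A n) (χ : G →ₜ* Aˣ) :
    (ρ.twist χ).IsAbsolutelyIrreducible ↔ ρ.IsAbsolutelyIrreducible := by
  refine ⟨fun h B _ f ↦ ?_, fun h B _ f ↦ ?_⟩
  · have h' := h B f
    rwa [baseChangeRepresentation_twist,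
      RepresentationTheory.Semisimple.Representation.isIrreducible_twist_iff] at h'
  · rw [baseChangeRepresentation_twist,
      RepresentationTheory.Semisimple.Representation.isIrreducible_twist_iff]
    exact h B f

/-- Twisting twice by a character with `χ² = 1` (pointwise) is the identity: `(ρ ⊗ χ) ⊗ χ = ρ`.
[folklore] -/
theorem twist_twist_self_of_sq_eq_one {A : Type v} [CommRing A] [TopologicalSpace A]
    [IsTopologicalRing A] (ρ : FramedRep G A n) (χ : G →ₜ* Aˣ) (hχ : ∀ g, χ g ^ 2 = 1) :
    (ρ.twist χ).twist χ = ρ := by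
  have h1 : χ * χ = 1 := ContinuousMonoidHom.ext fun g ↦ by
    rw [ContinuousMonoidHom.mul_apply, ← sq, hχ]; rfl
  rw [twist_twist, h1, twist_one]

end FramedRep

end Literature.NumberTheory.GaloisRepresentations

/-! ## The normalised wild cases and the assembly of Theorem 2.2.1 through them -/

namespace Literature.NumberTheory.Automorphic.BCDT

open GaloisRepresentations GaloisRepresentations.GL2F5OrderThree EllipticCurves.ModularForms
  WeierstrassCurve

/-- **BCDT's normal form of a wild `ρ̄ : Γ_ℚ → GL₂(𝔽₅)` at `3` (proof of Thm. 2.2.1, cases 2–6,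
p. 860), as a predicate.**  `ρ̄'` is *wild-normalised at `3`* if `det ρ̄' = χ̄₅`, `ρ̄'` is not tamely
ramified above `3`, and for some prime `𝔓 ∣ 3` of `\bar ℤ` and some `x ∈ GL₂(𝔽₅)`, with `f = x ρ̄' x⁻¹`,
`D = D_𝔓`, `I = I_𝔓`, `H = f⁻¹(𝔽₅(τ)^×)`: `f(D) ≤ N(𝔽₅(τ)^×)`, `f(Γ^u(𝔓)) ≤ ⟨τ⟩` for all `u > 0`
with equality for some `u > 0` ("`4 ↦ τ`"), and either `f(I) = ⟨τ⟩` ("`-1 ↦ 1`", cases 2–3) with,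
if `D ≤ H` (case 2), an arithmetic Frobenius `φ` of value `f φ = ν = τ - τ⁻¹`
("`3 ↦ τⁱ(τ - τ⁻¹)`"), or `f(I) = ⟨τ, σ⟩` (cases 4–6) with an arithmetic Frobenius `φ ∈ H` of value
`ν` ("`√±3 ↦ τ - τ⁻¹`").  This is verbatim the conclusion of
`exists_twist_conj_of_not_isTamelyRamifiedAbove_three_of_det` (`BCDTTheoremBWildAtThreeNormalised`),
where the dictionary with the printed characters of `ℚ₃^×`, `ℚ₃(√-1)^×`, `ℚ₃(√±3)^×` is explained.
[cite: BCDTJAMS2001, §2.2 (proof of Thm. 2.2.1, p. 860, cases 2–6)] -/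
def IsWildNormalisedAtThree (ρ : ModPGaloisRep ℚ (ZMod 5) 2) : Prop :=
  (∀ σ : absoluteGaloisGroup ℚ,
      Matrix.GeneralLinearGroup.det (ρ σ) = modPCyclotomicCharacterZMod ℚ 5 σ) ∧
  ¬ ρ.IsTamelyRamifiedAbove 3 ∧
  ∃ v : HeightOneSpectrum (𝓞 ℚ), ((3 : ℕ) : 𝓞 ℚ) ∈ v.asIdeal ∧ ∃ 𝔓 ∈ v.primesAbove,
    ∃ x : GL (Fin 2) (ZMod 5),
      (∀ σ ∈ 𝔓.decompositionSubgroup (absoluteGaloisGroup ℚ),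
          x * ρ σ * x⁻¹ ∈ Subgroup.normalizer (unitsF5Tau : Set (GL (Fin 2) (ZMod 5)))) ∧
      (∀ u : ℝ, 0 < u → ∀ σ ∈ absUpperRamificationSubgroup (𝓞 ℚ) 𝔓 u,
          x * ρ σ * x⁻¹ ∈ Subgroup.zpowers tau) ∧
      (∃ u : ℝ, 0 < u ∧
        (absUpperRamificationSubgroup (𝓞 ℚ) 𝔓 u).map
            ((MulAut.conj x).toMonoidHom.comp ρ.toMonoidHom) = Subgroup.zpowers tau) ∧
      (((𝔓.inertia (absoluteGaloisGroup ℚ)).map ((MulAut.conj x).toMonoidHom.comp ρ.toMonoidHom) =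
            Subgroup.zpowers tau ∧
          (𝔓.decompositionSubgroup (absoluteGaloisGroup ℚ) ≤
              unitsF5Tau.comap ((MulAut.conj x).toMonoidHom.comp ρ.toMonoidHom) →
            ∃ φ : absoluteGaloisGroup ℚ, IsArithFrobAt (𝓞 ℚ) φ 𝔓 ∧ x * ρ φ * x⁻¹ = nu)) ∨
        ((𝔓.inertia (absoluteGaloisGroup ℚ)).map ((MulAut.conj x).toMonoidHom.comp ρ.toMonoidHom) =
            Subgroup.closure {tau, sigma} ∧
          ∃ φ : absoluteGaloisGroup ℚ, IsArithFrobAt (𝓞 ℚ) φ 𝔓 ∧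
            φ ∈ unitsF5Tau.comap ((MulAut.conj x).toMonoidHom.comp ρ.toMonoidHom) ∧
            x * ρ φ * x⁻¹ = nu))

/-- A wild-normalised `ρ̄'` has cyclotomic determinant. [folklore] -/
theorem IsWildNormalisedAtThree.det_eq {ρ : ModPGaloisRep ℚ (ZMod 5) 2}
    (h : IsWildNormalisedAtThree ρ) (σ : absoluteGaloisGroup ℚ) :
    Matrix.GeneralLinearGroup.det (ρ σ) = modPCyclotomicCharacterZMod ℚ 5 σ :=
  h.1 σ

/-- A wild-normalised `ρ̄'` is not tamely ramified above `3`. [folklore] -/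
theorem IsWildNormalisedAtThree.not_isTamelyRamifiedAbove {ρ : ModPGaloisRep ℚ (ZMod 5) 2}
    (h : IsWildNormalisedAtThree ρ) : ¬ ρ.IsTamelyRamifiedAbove 3 :=
  h.2.1

/-- **"Up to equivalence and twisting by a quadratic character, one of the possibilities 2–6 can
be attained"** (BCDT, proof of Thm. 2.2.1, p. 860), in the form consumed by the assembly: for a
continuous `ρ̄ : Γ_ℚ → GL₂(𝔽₅)` with `det ρ̄ = χ̄₅`, not tamely ramified above `3`, there is a
continuous character `χ : Γ_ℚ → 𝔽₅^×` with `χ² = 1` — namely one of `1, ε₋₃, ε₋₁, ε₋₁ε₋₃` — such that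
the twist `ρ̄ ⊗ χ` is wild-normalised at `3` (`IsWildNormalisedAtThree`) and `ρ̄ = (ρ̄ ⊗ χ) ⊗ χ`.
Repackaging of `exists_twist_conj_of_not_isTamelyRamifiedAbove_three_of_det`.
[cite: BCDTJAMS2001, §2.2 (proof of Thm. 2.2.1, p. 860, cases 2–6)] -/
theorem exists_quadratic_twist_isWildNormalisedAtThree (ρ : ModPGaloisRep ℚ (ZMod 5) 2)
    (hdet : ∀ σ : absoluteGaloisGroup ℚ,
      Matrix.GeneralLinearGroup.det (ρ σ) = modPCyclotomicCharacterZMod ℚ 5 σ)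
    (hwild : ¬ ρ.IsTamelyRamifiedAbove 3) :
    ∃ χ : absoluteGaloisGroup ℚ →ₜ* (ZMod 5)ˣ,
      (χ = 1 ∨ χ = epsNegThree ∨ χ = epsNegOne ∨ χ = epsNegOne * epsNegThree) ∧
      (∀ g, χ g ^ 2 = 1) ∧
      IsWildNormalisedAtThree (ρ.twist χ) ∧ (ρ.twist χ).twist χ = ρ := by
  obtain ⟨ρ', hρ', hdet', hwild', hnf⟩ :=
    exists_twist_conj_of_not_isTamelyRamifiedAbove_three_of_det ρ hdet hwild
  -- the quadratic character `χ` with `ρ' = ρ ⊗ χ`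
  obtain ⟨χ, hχ, hχsq, hρ'χ⟩ : ∃ χ : absoluteGaloisGroup ℚ →ₜ* (ZMod 5)ˣ,
      (χ = 1 ∨ χ = epsNegThree ∨ χ = epsNegOne ∨ χ = epsNegOne * epsNegThree) ∧
      (∀ g, χ g ^ 2 = 1) ∧ ρ' = ρ.twist χ := by
    rcases hρ' with h | h | h | h
    · exact ⟨1, Or.inl rfl, fun g ↦ by rw [ContinuousMonoidHom.coe_one, Pi.one_apply, one_pow],
        by rw [h, FramedRep.twist_one]⟩
    · exact ⟨epsNegThree, Or.inr (Or.inl rfl), epsNegThree_sq, h⟩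
    · exact ⟨epsNegOne, Or.inr (Or.inr (Or.inl rfl)), epsNegOne_sq, h⟩
    · refine ⟨epsNegOne * epsNegThree, Or.inr (Or.inr (Or.inr rfl)), fun g ↦ ?_,
        by rw [h, FramedRep.twist_twist]⟩
      rw [ContinuousMonoidHom.mul_apply, mul_pow, epsNegOne_sq, epsNegThree_sq, one_mul]
  subst hρ'χ
  exact ⟨χ, hχ, hχsq, ⟨hdet', hwild', hnf⟩, FramedRep.twist_twist_self_of_sq_eq_one ρ χ hχsq⟩

/-- **The normalised wild cases imply nothing less than the old wild-case fact asks**: the named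
fact `exists_isTorsionGaloisRep_and_isModular_of_not_isTamelyRamifiedAbove` ("for every absolutely
irreducible wild `ρ̄` with `det = χ̄₅` there is a modular `E / ℚ` with `E[5] ≅ ρ̄`") implies its
restriction to wild-normalised `ρ̄'`, which is hypothesis (i) of
`theoremB_of_wildNormalised_of_twist_of_auxiliaryCurve_CDT721`. [folklore] -/
theorem wildNormalised_of_wild
    (hW : exists_isTorsionGaloisRep_and_isModular_of_not_isTamelyRamifiedAbove)
    (ρ : ModPGaloisRep ℚ (ZMod 5) 2) (hirr : FramedRep.IsAbsolutelyIrreducible ρ)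
    (hn : IsWildNormalisedAtThree ρ) :
    ∃ (W : WeierstrassCurve ℚ) (_ : W.IsElliptic) (_ : NeZero (W.conductorNorm ℤ)),
      W.IsTorsionGaloisRep 5 ρ ∧ IsModular W :=
  hW ρ hirr hn.det_eq hn.not_isTamelyRamifiedAbove

/-- **BCDT Theorem 2.2.1 for one `ρ̄`, through the normalised wild cases.**  Granted
(i) `hWn`: for every absolutely irreducible wild-normalised `ρ̄' : Γ_ℚ → GL₂(𝔽₅)`
(`IsWildNormalisedAtThree`) there is a modular elliptic curve `E / ℚ` with `E[5] ≅ ρ̄'` — BCDT §2.2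
cases 2–6 as printed (the curves `E₁ / ℚ₃` of [Man] and Cor. 2.3.2, `E / ℚ` by [SBT] §1 and Ekedahl,
CDT Prop. B.4.2, Lemmas 2.1.1/2.1.3/2.1.5, Thms. 2.1.2/2.1.4/2.1.6, Langlands–Tunnell,
Thms. 1.4.1–1.4.2: "We deduce that `E` is modular");
(ii) `hTw`: modularity of mod-`5` representations of `Γ_ℚ` is invariant under twisting by continuous
quadratic characters (BCDT's tacit step in "up to equivalence and twisting by a quadratic character":
`ρ̄ ⊗ χ ≅ ρ̄_{g,λ}` gives `ρ̄ ≅ ρ̄_{g ⊗ χ,λ}`; Shimura 1971, Prop. 3.64, and, for the newform wording of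
`ModPGaloisRep.IsModular`, the newform attached to the eigenform `g ⊗ χ`, Atkin–Li 1978, §3);
(iii) `hE`: the Shepherd-Barron–Taylor auxiliary curve; (iv) `h721`: CDT Thm. 7.2.1 —
a continuous absolutely irreducible `ρ̄ : Γ_ℚ → GL₂(𝔽₅)` with `det ρ̄ = χ̄₅` is modular.
Proof as printed: if `ρ̄` is tamely ramified above `3` (case 1), `E` with `E[5] ≅ ρ̄` and `ρ̄_{E,3}`
surjective is modular by CDT Thm. 7.2.1
(`exists_isTorsionGaloisRep_and_isModular_of_isTamelyRamifiedAbove_of_auxiliaryCurve_CDT721`,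
proved), so `ρ̄ ≅ ρ̄_{E,5}` is modular (`IsModular.isModular_of_isTorsionGaloisRep'`, proved);
otherwise some quadratic twist `ρ̄' = ρ̄ ⊗ χ` is wild-normalised
(`exists_quadratic_twist_isWildNormalisedAtThree`), still absolutely irreducible
(`FramedRep.isAbsolutelyIrreducible_twist_iff`), so by (i) `ρ̄' ≅ ρ̄_{E,5}` for a modular `E`, `ρ̄'`
is modular, and `ρ̄ = ρ̄' ⊗ χ` is modular by (ii).
[cite: BCDTJAMS2001, §2.2 (proof of Thm. 2.2.1)] -/
theorem isModular_of_wildNormalised_of_twist_of_auxiliaryCurve_CDT721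
    (hWn : ∀ ρ' : ModPGaloisRep ℚ (ZMod 5) 2, FramedRep.IsAbsolutelyIrreducible ρ' →
      IsWildNormalisedAtThree ρ' →
      ∃ (W : WeierstrassCurve ℚ) (_ : W.IsElliptic) (_ : NeZero (W.conductorNorm ℤ)),
        W.IsTorsionGaloisRep 5 ρ' ∧ IsModular W)
    (hTw : ∀ (ρ' : ModPGaloisRep ℚ (ZMod 5) 2) (χ : absoluteGaloisGroup ℚ →ₜ* (ZMod 5)ˣ),
      (∀ g, χ g ^ 2 = 1) → ρ'.IsModular → ModPGaloisRep.IsModular (ρ'.twist χ))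
    (hE : exists_isTorsionGaloisRep_five_and_surjective_three) (h721 : CDT_theorem_7_2_1)
    (ρ : ModPGaloisRep ℚ (ZMod 5) 2) (hirr : FramedRep.IsAbsolutelyIrreducible ρ)
    (hdet : ∀ σ : absoluteGaloisGroup ℚ,
      Matrix.GeneralLinearGroup.det (ρ σ) = modPCyclotomicCharacterZMod ℚ 5 σ) :
    ρ.IsModular := by
  by_cases htame : ρ.IsTamelyRamifiedAbove 3
  · -- case 1: tamely ramified above `3`
    obtain ⟨W, _, _, hρ, hmod⟩ :=
      exists_isTorsionGaloisRep_and_isModular_of_isTamelyRamifiedAbove_of_auxiliaryCurve_CDT721 hE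
        h721 ρ hirr hdet htame
    exact hmod.isModular_of_isTorsionGaloisRep'
      (W.trace_galoisRepTate_frobenius_of_hasGoodReductionAt_holds 5) hρ
  · -- cases 2–6: normalise a quadratic twist, conclude for it, untwist
    obtain ⟨χ, -, hχsq, hn, hρχ⟩ := exists_quadratic_twist_isWildNormalisedAtThree ρ hdet htame
    have hirr' : FramedRep.IsAbsolutelyIrreducible (ρ.twist χ) :=
      (FramedRep.isAbsolutelyIrreducible_twist_iff ρ χ).mpr hirr
    obtain ⟨W, _, _, hρ', hmod⟩ := hWn (ρ.twist χ) hirr' hn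
    have hmod' : ModPGaloisRep.IsModular (ρ.twist χ) :=
      hmod.isModular_of_isTorsionGaloisRep'
        (W.trace_galoisRepTate_frobenius_of_hasGoodReductionAt_holds 5) hρ'
    have h := hTw (ρ.twist χ) χ hχsq hmod'
    rwa [hρχ] at h

/-- **BCDT Theorem B = Theorem 2.2.1 from the NORMALISED wild cases 2–6, twist invariance of
modularity, the auxiliary curve and CDT Thm. 7.2.1 — nothing else.**  Compared with
`theoremB_of_wild_auxiliaryCurve_CDT721` (trust base {wild case for ALL wild `ρ̄`, auxiliary curve,
CDT 7.2.1}), the wild input is cut down to BCDT's five normal forms (hypothesis `hWn`, see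
`IsWildNormalisedAtThree`; implied by the old input, `wildNormalised_of_wild`) at the price of the
classical twist invariance `hTw`, the reduction "up to equivalence and twisting by a quadratic
character" being supplied by the tree (`BCDTTheoremBWildAtThree*`).
[cite: BCDTJAMS2001, Theorem 2.2.1 (proof, p. 860)] -/
theorem theoremB_of_wildNormalised_of_twist_of_auxiliaryCurve_CDT721
    (hWn : ∀ ρ' : ModPGaloisRep ℚ (ZMod 5) 2, FramedRep.IsAbsolutelyIrreducible ρ' →
      IsWildNormalisedAtThree ρ' →
      ∃ (W : WeierstrassCurve ℚ) (_ : W.IsElliptic) (_ : NeZero (W.conductorNorm ℤ)),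
        W.IsTorsionGaloisRep 5 ρ' ∧ IsModular W)
    (hTw : ∀ (ρ' : ModPGaloisRep ℚ (ZMod 5) 2) (χ : absoluteGaloisGroup ℚ →ₜ* (ZMod 5)ˣ),
      (∀ g, χ g ^ 2 = 1) → ρ'.IsModular → ModPGaloisRep.IsModular (ρ'.twist χ))
    (hE : exists_isTorsionGaloisRep_five_and_surjective_three) (h721 : CDT_theorem_7_2_1) :
    theoremB :=
  fun ρ hirr hdet ↦
    isModular_of_wildNormalised_of_twist_of_auxiliaryCurve_CDT721 hWn hTw hE h721 ρ hirr hdet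

/-- The old assembly is a special case of the new one: with the wild case granted for ALL wild
`ρ̄` (`exists_isTorsionGaloisRep_and_isModular_of_not_isTamelyRamifiedAbove`), hypothesis `hWn`
holds (`wildNormalised_of_wild`); so {old wild fact, twist invariance, auxiliary curve, CDT 7.2.1}
also give Theorem B through the normalised route (sanity check of the bookkeeping; of course
`theoremB_of_wild_auxiliaryCurve_CDT721` does not even need `hTw`). [folklore] -/
theorem theoremB_of_wild_of_twist_of_auxiliaryCurve_CDT721
    (hW : exists_isTorsionGaloisRep_and_isModular_of_not_isTamelyRamifiedAbove)
    (hTw : ∀ (ρ' : ModPGaloisRep ℚ (ZMod 5) 2) (χ : absoluteGaloisGroup ℚ →ₜ* (ZMod 5)ˣ),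
      (∀ g, χ g ^ 2 = 1) → ρ'.IsModular → ModPGaloisRep.IsModular (ρ'.twist χ))
    (hE : exists_isTorsionGaloisRep_five_and_surjective_three) (h721 : CDT_theorem_7_2_1) :
    theoremB :=
  theoremB_of_wildNormalised_of_twist_of_auxiliaryCurve_CDT721 (wildNormalised_of_wild hW) hTw hE
    h721

/-- **BCDT Theorem A (`exists_isNewformOf`, the Modularity Theorem in the tree's form) with
Theorem B unfolded through the normalised wild cases**: from (i) the normalised wild cases 2–6,
(ii) twist invariance of modularity, (iii) the auxiliary curve, (iv) CDT Thm. 7.1.2 and (v) CDT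
Thm. 7.2.2 (`exists_isNewformOf_of_theoremB_CDT712_722` with Theorem B discharged by
`theoremB_of_wildNormalised_of_twist_of_auxiliaryCurve_CDT721` and `CDT_theorem_7_2_1_of_7_1_2`).
[cite: BCDTJAMS2001, Theorem A and Thm. 2.2.2] -/
theorem exists_isNewformOf_of_wildNormalised_of_twist_of_auxiliaryCurve_CDT712_722
    (hWn : ∀ ρ' : ModPGaloisRep ℚ (ZMod 5) 2, FramedRep.IsAbsolutelyIrreducible ρ' →
      IsWildNormalisedAtThree ρ' →
      ∃ (W : WeierstrassCurve ℚ) (_ : W.IsElliptic) (_ : NeZero (W.conductorNorm ℤ)),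
        W.IsTorsionGaloisRep 5 ρ' ∧ IsModular W)
    (hTw : ∀ (ρ' : ModPGaloisRep ℚ (ZMod 5) 2) (χ : absoluteGaloisGroup ℚ →ₜ* (ZMod 5)ˣ),
      (∀ g, χ g ^ 2 = 1) → ρ'.IsModular → ModPGaloisRep.IsModular (ρ'.twist χ))
    (hE : exists_isTorsionGaloisRep_five_and_surjective_three) (h712 : CDT_theorem_7_1_2)
    (h722 : CDT_theorem_7_2_2) : EllipticCurves.ModularForms.exists_isNewformOf :=
  exists_isNewformOf_of_theoremB_CDT712_722
    (theoremB_of_wildNormalised_of_twist_of_auxiliaryCurve_CDT721 hWn hTw hE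
      (CDT_theorem_7_2_1_of_7_1_2 h712))
    h712 h722

end Literature.NumberTheory.Automorphic.BCDT

end
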